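import Summits.AtomisticToContinuum.FouriersLaw.Theorems.LatticeLandauDampingAbelThermodynamicLimitFixedFrequencyMatchingOfFixedTime
import Summits.AtomisticToContinuum.FouriersLaw.Theorems.LatticeLandauDampingAbelThermodynamicLimitFixedFrequencyMatchingUniformLeaves
import Summits.AtomisticToContinuum.FouriersLaw.Theorems.LatticeLandauDampingAbelThermodynamicLimitUniformAnchoredCorrelationTails
import Summits.AtomisticToContinuum.FouriersLaw.Theorems.LatticeLandauDampingAbelThermodynamicLimitOffsetMatchingOfEngines
import HarnessLib

/-!
# Stub (M) `stub_fixedFrequencyMatching` of line `loomis-compact-horizon-witness` (rev 5) — PROVED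
(crux `EmbeddedDrudeMourre.AbelThermodynamicLimit`, item stmt-AtomisticToContinuum-12596; `--supports` file proving the
registered stub (M) VERBATIM — it is also, verbatim, stub S3 `stub_fixedFrequencyMatching` of the `Iff.rfl`-twin crux
stmt-AtomisticToContinuum-14013, line `series-law-at-every-laplace-frequency`; closes nothing)

**Fixed-frequency open/closed matching for regular pairs.** For `P = pinnedChain ω₂ lam β γ` (all `> 0`), `T > 0` with DLR
uniqueness in the regular class (inline hypothesis), every regular pair `(μT, D)` (DLR + shift-invariant + BM-superstable state,
`D.carrier ⊆ bmGood`, `μT`-preserving, absolutely convergent correlations) and every `ν > 0`: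
`F_N(ν)/N → Â(ν) := ∫₀^∞ e^{-νt} C_T(t) dt`, where `F_N(ν) = ∫₀^∞ e^{-νt} c_N(t) dt`, `c_N(t) = ∫ J · P_t J dμ_{N,T}` is the
equilibrium total-current autocorrelation of the OPEN `N`-chain (both baths at `T`) and `C_T = D.currentCorrelation μT`.

Proof = pure assembly of the twin seat's LANDED theorems (namespace `…Theorems.AbelThermodynamicLimit.SeriesLawAtEveryLaplaceFrequency`):
(B′) anchor-uniform per-offset fixed-time matching `stub_uniformFixedTimeOffsetMatching` (p-landed 2026-08-16T21:08Z, from the engines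
bulk-window equivalence of ensembles + `N`-uniform open-chain severed locality) and (C′) anchor-uniform correlation tails
`stub_uniformAnchoredCorrelationTails` (the `N`-uniform open-chain light cone) give FIXED-TIME bond-averaged matching
`c_N(t)/N → C_T(t)` for every `t > 0` (`stub_fixedTimeMatchingOfUniformLeaves`); dominated convergence in `t` against `B e^{-νt}`
(`stub_fixedFrequencyMatchingOfFixedTime`, with the `N`-uniform per-length bound `|c_N(t)| ≤ B·N` inside) gives the claim.
Disproof §4 step (2). References: Buttà–Marchioro 2016 (light cone), Bonetto–Lebowitz–Rey-Bellet 2000 §7, Kundu–Dhar–Narayan 2009.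
No definitions.
-/

noncomputable section

namespace Summit.AtomisticToContinuum.FouriersLaw.Theorems.AbelThermodynamicLimit.LoomisCompactHorizonWitness

open MeasureTheory Filter Set
open Summit.AtomisticToContinuum.FouriersLaw.Theorems.AbelThermodynamicLimit.SeriesLawAtEveryLaplaceFrequency
  (stub_fixedFrequencyMatchingOfFixedTime stub_fixedTimeMatchingOfUniformLeaves stub_uniformAnchoredCorrelationTails
   stub_uniformFixedTimeOffsetMatching)

/-- **(M) `stub_fixedFrequencyMatching` — fixed-frequency open/closed matching for regular pairs** (registered stub of
line `loomis-compact-horizon-witness`, crux stmt-12596; verbatim the twin crux's S3): for every `ν > 0`,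
`F_N(ν)/N → ∫₀^∞ e^{-νt} C_T(t) dt`.  Assembly of (B′) + (C′) ⇒ fixed-time matching ⇒ dominated convergence. [folklore] -/
theorem stub_fixedFrequencyMatching :
    ∀ ω₂ lam β γ : ℝ, 0 < ω₂ → 0 < lam → 0 < β → 0 < γ → ∀ T : ℝ, 0 < T →
      (∀ μ₁ μ₂ : MeasureTheory.Measure
            Literature.MathematicalPhysics.KineticTheory.HeatConduction.ChainConfig,
          (Literature.MathematicalPhysics.KineticTheory.HeatConduction.pinnedChain
                ω₂ lam β γ).IsChainGibbsMeasure T μ₁ →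
          Literature.MathematicalPhysics.KineticTheory.HeatConduction.IsShiftInvariant μ₁ →
          (Literature.MathematicalPhysics.KineticTheory.HeatConduction.pinnedChain
                ω₂ lam β γ).HasSuperstabilityEstimate μ₁ →
          (Literature.MathematicalPhysics.KineticTheory.HeatConduction.pinnedChain
                ω₂ lam β γ).IsChainGibbsMeasure T μ₂ →
          Literature.MathematicalPhysics.KineticTheory.HeatConduction.IsShiftInvariant μ₂ →
          (Literature.MathematicalPhysics.KineticTheory.HeatConduction.pinnedChain
                ω₂ lam β γ).HasSuperstabilityEstimate μ₂ → μ₁ = μ₂) →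

      ∀ (μT : MeasureTheory.Measure
            Literature.MathematicalPhysics.KineticTheory.HeatConduction.ChainConfig)
        (D : Literature.MathematicalPhysics.KineticTheory.HeatConduction.InfiniteChainDynamics
          (Literature.MathematicalPhysics.KineticTheory.HeatConduction.pinnedChain ω₂ lam β γ)),
        (Literature.MathematicalPhysics.KineticTheory.HeatConduction.pinnedChain
            ω₂ lam β γ).IsChainGibbsMeasure T μT →
        Literature.MathematicalPhysics.KineticTheory.HeatConduction.IsShiftInvariant μT →
        (Literature.MathematicalPhysics.KineticTheory.HeatConduction.pinnedChain
            ω₂ lam β γ).HasSuperstabilityEstimate μT →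
        D.carrier ⊆ (Literature.MathematicalPhysics.KineticTheory.HeatConduction.pinnedChain
            ω₂ lam β γ).bmGood →
        D.PreservesMeasure μT →
        (∀ t : ℝ, D.HasAbsConvergentCorrelation μT t) →
        ∀ ν : ℝ, 0 < ν →
          Filter.Tendsto (fun N : ℕ =>
              MeasureTheory.integral (MeasureTheory.volume.restrict (Set.Ioi (0:ℝ))) (fun t : ℝ =>
                Real.exp (-(ν * t)) *
                  ∫ z, (∑ i : Fin N, (Literature.MathematicalPhysics.KineticTheory.HeatConduction.pinnedChain
                          ω₂ lam β γ).bondCurrent N i z) *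
                    (∫ y, (∑ i : Fin N, (Literature.MathematicalPhysics.KineticTheory.HeatConduction.pinnedChain
                          ω₂ lam β γ).bondCurrent N i y)
                      ∂((Literature.MathematicalPhysics.KineticTheory.HeatConduction.pinnedChain
                          ω₂ lam β γ).transitionKernel N T T t.toNNReal z))
                    ∂((Literature.MathematicalPhysics.KineticTheory.HeatConduction.pinnedChain
                          ω₂ lam β γ).gibbsMeasure N T)) / (N : ℝ))
            Filter.atTop
            (nhds (MeasureTheory.integral (MeasureTheory.volume.restrict (Set.Ioi (0:ℝ)))
              (fun t : ℝ => Real.exp (-(ν * t)) * D.currentCorrelation μT t))) := by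
  intro ω₂ lam β γ hω hl hβ hγ T hT hU μT D hG hS hss hcar hP hAC ν hν
  refine stub_fixedFrequencyMatchingOfFixedTime ω₂ lam β γ hω hl hβ hγ T hT hU μT D hG hS hss hcar hP hAC ?_ ν hν
  -- fixed-time bond-averaged matching for every `t > 0`, from the two anchor-uniform dynamical leaves
  have hB := stub_uniformFixedTimeOffsetMatching ω₂ lam β γ hω hl hβ hγ T hT hU μT D hG hS hss hcar hP hAC
  refine (MeasureTheory.ae_restrict_iff' measurableSet_Ioi).2 (MeasureTheory.ae_of_all _ fun t ht => ?_)
  refine stub_fixedTimeMatchingOfUniformLeaves ω₂ lam β γ hω hl hβ hγ T hT μT D hAC hB ?_ t ht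
  intro s hs ε hε
  obtain ⟨R, N₀, h⟩ := stub_uniformAnchoredCorrelationTails ω₂ lam β γ hω hl hβ hγ T hT s hs ε hε
  exact ⟨R, N₀, fun N hN i h1 h2 => h N hN i h1 h2 s ⟨hs.le, le_rfl⟩⟩

end Summit.AtomisticToContinuum.FouriersLaw.Theorems.AbelThermodynamicLimit.LoomisCompactHorizonWitness

end
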